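import Literature.Probability.RandomPlanarGeometry.SAWPolygonExtremalVertices
import HarnessLib

/-!
# Joining two polygons side by side: the join `J(p, τ(q))` of DGHM20 Lemma 3.3 on `ℤ²`

Topic `Literature/Probability/RandomPlanarGeometry` (continues `SAWWidePolygons.lean`,
`SAWPolygonExtremalVertices.lean`; uses the two-rung polygon merge `IsPolygon.merge` of
`SAWPolygonSurgery.lean`).

Source: H. Duminil-Copin, S. Ganguly, A. Hammond, I. Manolescu, *Bounding the number of
self-avoiding walks: Hammersley–Welsh with polygon insertion*, Ann. Probab. 48 (2020),
arXiv:1809.00760, proof of Lemma 3.3 (p. 11 of the arXiv text): "The polygon `q` may be reflected in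
the vertical axis, via the reflection `τ`, and then horizontally translated to such a position that
its vertex in correspondence with `EN(q)` is to be found one unit directly to the right of `EN(p)`.
The union of the edges that comprise `p` and this translation of `τ(q)` intersects the four edges of
the plaquette whose north-west corner is `EN(p)` along the west and east sides of the plaquette. By
replacing these two edges in the union by the plaquette's north and south sides, a polygon of length
`2(2m+2)` results. This polygon is `J(p,τ(q))`. … The height of this polygon is at most
`height(p) + height(q) ≤ 2u` … `J(p,τ(q))` realizes its line-width
`lwidth(J(p,τ(q))) = width(p) + width(q) + 1 > u` at height zero."
(Here `p`, `q` are represented by NORMAL edge sets and paired by `relHeight p = relHeight q`, the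
height of `EN` above `WS`, which is the source's "`y(EN(p)) = y(EN(q))`" for `WS`-rooted polygons; the
translation of `τ(q)` then has a vertical component, immaterial up to translation.)

## Contents (namespace `Literature.Probability.RandomPlanarGeometry.SAW`), all PROVED

* `qImage p q` — the reflected, translated copy of `q` with west-north vertex `EN(p) + e₀`;
* `dghmJoin p q` — **the join `J(p, τ(q))`**; `isPolygon_dghmJoin` (a polygon with `#p + #q` edges,
  via `IsPolygon.merge` along the unit rungs `EN(p) → EN(p)+e₀`, `EN(p)−e₁ → EN(p)+e₀−e₁`);
* `vertsOf_subset_vertsOf_dghmJoin`, `vertsOf_qImage_subset_vertsOf_dghmJoin`,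
  `vertsOf_dghmJoin_subset` — the vertices of the join;
* `hasHeightLe_dghmJoin` (`height ≤ h_p + h_q`), `hasLWidthGe_dghmJoin`
  (`lwidth ≥ w_p + w_q + 1` when `relHeight p = relHeight q`).

NOT here: that `J` determines `(p, q)` and the counting — `SAWWidePolygonsJoinCount.lean`.
-/

noncomputable section

open Finset SimpleGraph Literature.Probability.LatticeModels Literature.Probability.Percolation
open Literature.Barriers.CriticalPhenomena.SupercriticalSAW (shiftEdges isPolygon_shiftEdges
  card_shiftEdges mem_shiftEdges_iff shiftEdges_injective)
open Literature.Probability.Percolation.SiteGadgetSystem (vertsOf mem_vertsOf)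

namespace Literature.Probability.RandomPlanarGeometry.SAW

/-! ### The join `J(p, τ(q))` -/

/-- The reflected and translated copy of `q` whose west-north vertex (the image of `EN(q)`) sits at
`EN(p) + e₀`. [cite: DuminilCopinGangulyHammondManolescu2020, §3.1 (proof of Lemma 3.3: "reflected in the vertical axis … and then horizontally translated")] -/
def qImage (p q : Finset (Sym2 (Site 2))) : Finset (Sym2 (Site 2)) :=
  shiftEdges (enV p + ex - Zd.reflAt 0 0 (enV q)) (reflEdges 0 q)

/-- The west-north vertex of the copy of `q` is `EN(p) + e₀`.
[cite: DuminilCopinGangulyHammondManolescu2020, §3.1 (proof of Lemma 3.3)] -/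
theorem isWN_qImage (p : Finset (Sym2 (Site 2))) {q : Finset (Sym2 (Site 2))} (hq : (vertsOf q).Nonempty) :
    IsWN (qImage p q) (enV p + ex) := by
  have h := ((isEN_enV hq).reflect 0).shift (enV p + ex - Zd.reflAt 0 0 (enV q))
  rwa [add_sub_cancel] at h

/-- A reflected translated polygon is a polygon with the same number of edges.
[cite: DuminilCopinGangulyHammondManolescu2020, §3.1 (proof of Lemma 3.3)] -/
theorem isPolygon_qImage (p : Finset (Sym2 (Site 2))) {q : Finset (Sym2 (Site 2))}
    (hq : IsPolygon (zdGraph 2) q) : IsPolygon (zdGraph 2) (qImage p q) ∧ (qImage p q).card = q.card :=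
  ⟨isPolygon_shiftEdges (isPolygon_reflEdges hq 0) _, by rw [qImage, card_shiftEdges, card_reflEdges]⟩

/-- **The join `J(p, τ(q))`** of DGHM20 Lemma 3.3: remove the west side `{a, a−e₁}` (`a = EN(p)`) of
the plaquette with north-west corner `a` from `p` and its east side `{a+e₀, a+e₀−e₁}` from the copy
of `q`, and add the plaquette's north and south sides.
[cite: DuminilCopinGangulyHammondManolescu2020, §3.1 (proof of Lemma 3.3: the join J)] -/
def dghmJoin (p q : Finset (Sym2 (Site 2))) : Finset (Sym2 (Site 2)) :=
  p.erase s(enV p, enV p - ey) ∪ (qImage p q).erase s(enV p + ex, enV p + ex - ey) ∪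
    ({s(enV p, enV p + ex)} ∪ {s(enV p - ey, enV p + ex - ey)})

section Join

variable {p q : Finset (Sym2 (Site 2))}

/-- Vertices of `p` lie weakly left of the column of `EN(p)`. [cite: DuminilCopinGangulyHammondManolescu2020, §3.1 (proof of Lemma 3.3)] -/
theorem apply_zero_le_of_mem_vertsOf (hp : (vertsOf p).Nonempty) {v : Site 2} (hv : v ∈ vertsOf p) :
    v 0 ≤ enV p 0 :=
  ((isEN_enV hp).2 v hv).1

/-- Vertices of the copy of `q` lie strictly right of the column of `EN(p)`.
[cite: DuminilCopinGangulyHammondManolescu2020, §3.1 (proof of Lemma 3.3)] -/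
theorem lt_apply_zero_of_mem_vertsOf_qImage (hq : (vertsOf q).Nonempty) {v : Site 2}
    (hv : v ∈ vertsOf (qImage p q)) : enV p 0 < v 0 := by
  have := ((isWN_qImage p hq).2 v hv).1
  simp only [Pi.add_apply, ex_zero] at this
  linarith

/-- **`J(p, τ(q))` is a polygon with `#p + #q` edges.** The plaquette surgery is the tree's two-rung
merge `IsPolygon.merge` along the unit rungs `a → a+e₀` and `a−e₁ → a+e₀−e₁`.
[cite: DuminilCopinGangulyHammondManolescu2020, §3.1 (proof of Lemma 3.3: "a polygon of length 2(2m+2) results")] -/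
theorem isPolygon_dghmJoin (hp : IsPolygon (zdGraph 2) p) (hq : IsPolygon (zdGraph 2) q) :
    IsPolygon (zdGraph 2) (dghmJoin p q) ∧ (dghmJoin p q).card = p.card + q.card := by
  classical
  have hpn := hp.vertsOf_nonempty
  have hqn := hq.vertsOf_nonempty
  obtain ⟨hq', hqcard⟩ := isPolygon_qImage p hq
  set a := enV p with ha
  have hab : s(a, a - ey) ∈ p := edge_down_mem_of_isEN hp (isEN_enV hpn)
  have hcd : s(a + ex, a + ex - ey) ∈ qImage p q := edge_down_mem_of_isWN hq' (isWN_qImage p hqn)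
  -- the rungs
  set R₁ : (zdGraph 2).Walk a (a + ex) := Walk.cons (adj_add_ex a) Walk.nil with hR₁
  set R₂ : (zdGraph 2).Walk (a - ey) (a - ey + ex) := Walk.cons (adj_add_ex (a - ey)) Walk.nil with hR₂
  have hR₁p : R₁.IsPath := by simp [hR₁, Walk.cons_isPath_iff]; intro h; have := congrFun h 0; simp at this
  have hR₂p : R₂.IsPath := by simp [hR₂, Walk.cons_isPath_iff]; intro h; have := congrFun h 0; simp at this
  have hde : a + ex - ey = a - ey + ex := by abel
  have hleft : ∀ x, (∃ e ∈ p, x ∈ e) → x 0 ≤ a 0 := fun x hx =>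
    apply_zero_le_of_mem_vertsOf hpn (mem_vertsOf.2 hx)
  have hright : ∀ x, (∃ e ∈ qImage p q, x ∈ e) → a 0 < x 0 := fun x hx =>
    lt_apply_zero_of_mem_vertsOf_qImage hqn (mem_vertsOf.2 hx)
  have key := IsPolygon.merge hp hq' hab (hde ▸ hcd) (R₁ := R₁) (R₂ := R₂) hR₁p hR₂p
    (fun x h1 h2 => by have := hleft x h1; have := hright x h2; linarith)
    (fun x hx h1 => by
      simp only [hR₁, Walk.support_cons, Walk.support_nil, List.mem_cons,
        List.not_mem_nil, or_false] at hx
      rcases hx with rfl | rfl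
      · rfl
      · have := hleft _ h1; simp at this)
    (fun x hx h2 => by
      simp only [hR₁, Walk.support_cons, Walk.support_nil, List.mem_cons,
        List.not_mem_nil, or_false] at hx
      rcases hx with rfl | rfl
      · have := hright _ h2; simp at this
      · rfl)
    (fun x hx h1 => by
      simp only [hR₂, Walk.support_cons, Walk.support_nil, List.mem_cons,
        List.not_mem_nil, or_false] at hx
      rcases hx with rfl | rfl
      · rfl
      · have := hleft _ h1; simp at this)
    (fun x hx h2 => by
      simp only [hR₂, Walk.support_cons, Walk.support_nil, List.mem_cons,
        List.not_mem_nil, or_false] at hx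
      rcases hx with rfl | rfl
      · have := hright _ h2; simp at this
      · rfl)
    (fun x hx hx' => by
      simp only [hR₁, hR₂, Walk.support_cons, Walk.support_nil, List.mem_cons,
        List.not_mem_nil, or_false] at hx hx'
      rcases hx with rfl | rfl <;> rcases hx' with h | h
      · have h' := congrFun h 1
        simp only [Pi.sub_apply, ey_one] at h'; omega
      · have h' := congrFun h 0
        simp only [Pi.add_apply, Pi.sub_apply, ex_zero, ey_zero] at h'; omega
      · have h' := congrFun h 0
        simp only [Pi.add_apply, Pi.sub_apply, ex_zero, ey_zero] at h'; omega
      · have h' := congrFun h 1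
        simp only [Pi.add_apply, Pi.sub_apply, ex_one, ey_one] at h'; omega)
  have hedges : R₁.edges.toFinset ∪ R₂.edges.toFinset =
      ({s(a, a + ex)} ∪ {s(a - ey, a + ex - ey)} : Finset (Sym2 (Site 2))) := by
    simp [hR₁, hR₂, hde]
  have hJ : dghmJoin p q = p.erase s(a, a - ey) ∪ (qImage p q).erase s(a + ex, a + ex - ey) ∪
      ({s(a, a + ex)} ∪ {s(a - ey, a + ex - ey)}) := by
    rw [ha]; rfl
  obtain ⟨hpoly, hcard⟩ := key
  simp only [hR₁, hR₂, Walk.length_cons, Walk.length_nil] at hcard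
  rw [hedges] at hpoly hcard
  rw [← hde] at hpoly hcard
  refine ⟨by rw [hJ]; exact hpoly, ?_⟩
  rw [hJ]
  omega

/-! ### Vertices, height and line-width of the join -/

/-- Every vertex of `p` survives in `J(p, τ(q))`. [cite: DuminilCopinGangulyHammondManolescu2020, §3.1 (proof of Lemma 3.3)] -/
theorem vertsOf_subset_vertsOf_dghmJoin (hp : IsPolygon (zdGraph 2) p) :
    vertsOf p ⊆ vertsOf (dghmJoin p q) := by
  intro v hv
  obtain ⟨b₁, b₂, hne, h₁, h₂, -, -⟩ := hp.exists_two_edges (mem_vertsOf.1 hv)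
  -- one of the two edges at `v` is not the removed west side
  have key : ∃ b, s(v, b) ∈ p ∧ s(v, b) ≠ s(enV p, enV p - ey) := by
    by_cases h : s(v, b₁) = s(enV p, enV p - ey)
    · refine ⟨b₂, h₂, fun h' => hne ?_⟩
      exact Sym2.congr_right.1 (h.trans h'.symm)
    · exact ⟨b₁, h₁, h⟩
  obtain ⟨b, hb, hbne⟩ := key
  refine mem_verts_of_mem (e := s(v, b)) ?_ (Sym2.mem_mk_left v b)
  rw [dghmJoin]
  exact Finset.mem_union_left _ (Finset.mem_union_left _ (Finset.mem_erase.2 ⟨hbne, hb⟩))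

/-- Every vertex of the copy of `q` survives in `J(p, τ(q))`. [cite: DuminilCopinGangulyHammondManolescu2020, §3.1 (proof of Lemma 3.3)] -/
theorem vertsOf_qImage_subset_vertsOf_dghmJoin (hq : IsPolygon (zdGraph 2) q) :
    vertsOf (qImage p q) ⊆ vertsOf (dghmJoin p q) := by
  intro v hv
  have hq' := (isPolygon_qImage p hq).1
  obtain ⟨b₁, b₂, hne, h₁, h₂, -, -⟩ := hq'.exists_two_edges (mem_vertsOf.1 hv)
  have key : ∃ b, s(v, b) ∈ qImage p q ∧ s(v, b) ≠ s(enV p + ex, enV p + ex - ey) := by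
    by_cases h : s(v, b₁) = s(enV p + ex, enV p + ex - ey)
    · refine ⟨b₂, h₂, fun h' => hne ?_⟩
      exact Sym2.congr_right.1 (h.trans h'.symm)
    · exact ⟨b₁, h₁, h⟩
  obtain ⟨b, hb, hbne⟩ := key
  refine mem_verts_of_mem (e := s(v, b)) ?_ (Sym2.mem_mk_left v b)
  rw [dghmJoin]
  exact Finset.mem_union_left _ (Finset.mem_union_right _ (Finset.mem_erase.2 ⟨hbne, hb⟩))

/-- The vertices of the join are vertices of `p` or of the copy of `q`.
[cite: DuminilCopinGangulyHammondManolescu2020, §3.1 (proof of Lemma 3.3)] -/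
theorem vertsOf_dghmJoin_subset (hp : IsPolygon (zdGraph 2) p) (hq : IsPolygon (zdGraph 2) q) :
    vertsOf (dghmJoin p q) ⊆ vertsOf p ∪ vertsOf (qImage p q) := by
  have hpn := hp.vertsOf_nonempty
  have hqn := hq.vertsOf_nonempty
  have ha : enV p ∈ vertsOf p := (isEN_enV hpn).1
  have hc : enV p + ex ∈ vertsOf (qImage p q) := (isWN_qImage p hqn).1
  have hb : enV p - ey ∈ vertsOf p :=
    mem_verts_of_mem (edge_down_mem_of_isEN hp (isEN_enV hpn)) (Sym2.mem_mk_right _ _)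
  have hd : enV p + ex - ey ∈ vertsOf (qImage p q) :=
    mem_verts_of_mem (edge_down_mem_of_isWN (isPolygon_qImage p hq).1 (isWN_qImage p hqn))
      (Sym2.mem_mk_right _ _)
  intro v hv
  obtain ⟨e, he, hve⟩ := mem_vertsOf.1 hv
  rw [dghmJoin] at he
  simp only [Finset.mem_union, Finset.mem_singleton] at he
  rw [Finset.mem_union]
  rcases he with (he | he) | (rfl | rfl)
  · exact Or.inl (mem_verts_of_mem (Finset.mem_of_mem_erase he) hve)
  · exact Or.inr (mem_verts_of_mem (Finset.mem_of_mem_erase he) hve)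
  · rcases Sym2.mem_iff.1 hve with rfl | rfl
    · exact Or.inl ha
    · exact Or.inr hc
  · rcases Sym2.mem_iff.1 hve with rfl | rfl
    · exact Or.inl hb
    · exact Or.inr hd

/-- **The height of the join is at most `h_p + h_q`** ("at most `height(p) + height(q) ≤ 2u`").
[cite: DuminilCopinGangulyHammondManolescu2020, §3.1 (proof of Lemma 3.3)] -/
theorem hasHeightLe_dghmJoin (hp : IsPolygon (zdGraph 2) p) (hq : IsPolygon (zdGraph 2) q) {h₁ h₂ : ℕ}
    (hh₁ : HasHeightLe p h₁) (hh₂ : HasHeightLe q h₂) : HasHeightLe (dghmJoin p q) (h₁ + h₂) := by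
  have hpn := hp.vertsOf_nonempty
  have hqn := hq.vertsOf_nonempty
  have hh₂' : HasHeightLe (qImage p q) h₂ := by
    rw [qImage, hasHeightLe_shiftEdges_iff, hasHeightLe_reflEdges_iff]; exact hh₂
  have ha : enV p ∈ vertsOf p := (isEN_enV hpn).1
  have hc : enV p + ex ∈ vertsOf (qImage p q) := (isWN_qImage p hqn).1
  have hc1 : (enV p + ex) 1 = enV p 1 := by simp
  have hsub := vertsOf_dghmJoin_subset hp hq (q := q)
  intro x hx y hy
  have hx' := Finset.mem_union.1 (hsub hx)
  have hy' := Finset.mem_union.1 (hsub hy)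
  push_cast
  rcases hx' with hx' | hx' <;> rcases hy' with hy' | hy'
  · linarith [hh₁ x hx' y hy']
  · have h1 := hh₁ x hx' (enV p) ha
    have h2 := hh₂' (enV p + ex) hc y hy'
    rw [hc1] at h2; linarith
  · have h1 := hh₂' x hx' (enV p + ex) hc
    have h2 := hh₁ (enV p) ha y hy'
    rw [hc1] at h1; linarith
  · linarith [hh₂' x hx' y hy']

/-- The width parameter is at most `x(EN) − x(WS)`. [cite: DuminilCopinGangulyHammondManolescu2020, §3.1 (proof of Lemma 3.3: "x(EN(p)) = width(p)")] -/
theorem le_enV_sub_wsV (hp : (vertsOf p).Nonempty) {w : ℕ} (hw : HasWidthGe p w) :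
    (w : ℤ) ≤ enV p 0 - wsV p 0 := by
  obtain ⟨a, ha, b, hb, hab⟩ := hw
  have h1 := ((isWS_wsV hp).2 a ha).1
  have h2 := ((isEN_enV hp).2 b hb).1
  linarith

/-- **The line-width of the join is at least `w_p + w_q + 1`** (realised on the row of `WS(p)`: the
join contains `WS(p)` and the image of `WS(q)`, which lie on one horizontal line because `EN(p)` and
`EN(q)` have the same height above `WS`). "`lwidth(J(p,τ(q))) = width(p) + width(q) + 1 > u`".
[cite: DuminilCopinGangulyHammondManolescu2020, §3.1 (proof of Lemma 3.3)] -/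
theorem hasLWidthGe_dghmJoin (hp : IsPolygon (zdGraph 2) p) (hq : IsPolygon (zdGraph 2) q)
    (hrel : relHeight p = relHeight q) {w₁ w₂ : ℕ} (hw₁ : HasWidthGe p w₁) (hw₂ : HasWidthGe q w₂) :
    HasLWidthGe (dghmJoin p q) (w₁ + w₂ + 1) := by
  have hpn := hp.vertsOf_nonempty
  have hqn := hq.vertsOf_nonempty
  -- the two witnesses: `WS(p)` and the image of `WS(q)`
  set z : Site 2 := Zd.reflAt 0 0 (wsV q) + (enV p + ex - Zd.reflAt 0 0 (enV q)) with hz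
  have hzmem : z ∈ vertsOf (qImage p q) := by
    rw [qImage]
    exact add_mem_vertsOf_shiftEdges.2 (mem_vertsOf_reflEdges.2 (by rw [Zd.reflAt_reflAt]; exact (isWS_wsV hqn).1))
  have hz0 : z 0 = enV p 0 + 1 + (enV q 0 - wsV q 0) := by
    simp only [hz, Pi.add_apply, Pi.sub_apply, Zd.reflAt_apply_same, ex_zero]; ring
  have hz1 : z 1 = wsV q 1 + enV p 1 - enV q 1 := by
    simp only [hz, Pi.add_apply, Pi.sub_apply, Zd.reflAt_apply_of_ne (show (1 : Fin 2) ≠ 0 by decide),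
      ex_one]; ring
  have hrel' : enV p 1 - wsV p 1 = enV q 1 - wsV q 1 := hrel
  refine ⟨wsV p, vertsOf_subset_vertsOf_dghmJoin hp (isWS_wsV hpn).1, z,
    vertsOf_qImage_subset_vertsOf_dghmJoin hq hzmem, ?_, ?_⟩
  · rw [hz1]; linarith
  · rw [hz0]
    have h1 := le_enV_sub_wsV hpn hw₁
    have h2 := le_enV_sub_wsV hqn hw₂
    push_cast; linarith

end Join

end Literature.Probability.RandomPlanarGeometry.SAW
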